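import Summits.QuantumFields.YangMills.Theorems.BalabanUVNodesN15BackgroundStep
import Literature.MathematicalPhysics.QuantumFieldTheory.Balaban1983to89.T4EtaRateCoeffDefect
import Literature.MathematicalPhysics.QuantumFieldTheory.King1986.TorusBlockForm
import HarnessLib

/-!
# Route «BalabanUVNodes» (K4 «SpineRates»), node N15 = NE2, THE -a ∕ -b INTERFACE OF THE BACKGROUND LAYER, part 1∕2: the matrix ENTRIES of
# the η-defect `𝔇(G′,G) = G′τ₁ − τ₂G` ⟺ its BLOCK MAJORANTS; binder (a) of the background step in entry form; the torus defect kernel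

Cell `pub-ymgap`, seat `pub-ymgap-dag-n15-a` (KNIT-BY-NAME, generation g2; HUMAN RULING D-0062 «Track A at full width»; chair R424 venue;
`bears_on: R4∕N15`).  Filed `--supports stmt-QuantumFields-19351` (spine leaf `BalabanLadder.UV`) until the node stub `S_N15` of route
«BalabanUVNodes» is an item.  THEOREMS ONLY; imports BY NAME, nothing in the tree modified: `BalabanUVNodesN15BackgroundStep` (seat n15-b,
p409422: `idef_background_propagator_majorant`), `T4EtaRateCoeffDefect` (cell `pub-balaban`, pv25: `pull`, `fibre`), through them
`T4EtaRateDefect` (`idef`), `B11SectG` (`BlockNorm.ofBlocks`, `HasMaj`, `RowSum`), `B9SectDWeightedNeumann` (`WRow`, `wrow_of_exp`),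
`B11AxialTransport190` (`abs_le_loc_ofBlocks`, `loc_ofBlocks_le`); `King1986.TorusBlockForm` (`site`, `blockOf`, `blockEquiv`).  Part 2∕2
(`BalabanUVNodesN15DefectKernelKing`) inhabits the interface by King's scalar minimiser (Prop. 3.8 (3.71), seat n18-b's `king_prop38_torus`).

WHAT N15 IS.  Statement of record (venue `HOME/lean/ym-dag/N15_NE2.lean`): `T4EtaRate.NE2PlusOperator c35 pi Kop ∧ NE2PlusSite 4 p c35 pi Ksite ∧
NE2PlusUnit c35 pi Kunit inΛ unitDist` — NOT PRINTED ([Balaban1985BackgroundPropagators] Thm 3.1 p. 397 ∕ Thm 3.15 p. 432 print UNIFORMITY in the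
spacing, never an η-difference).  The -a seat's g0 files knit the three conjuncts BY NAME for the Landau-gauge vector linear theory at `U ≡ 1` in the
lineage's COLLAPSED torus model (`NE2NodeTorus` p408986, `BalabanUVNodesN15Knit` p409413, `BalabanUVNodesN15RootB` p409877).  The -b seat's
background-layer chain (`…N15DerivDefect*`, `…N15FirstOrderDefect`, `…N15BackgroundStep`, `…N15BackgroundEntries`) reduces NE2⁺-LOCAL to binders
(a)–(f) IN THE BLOCK-MAJORANT CURRENCY of `B11SectG` on the HONEST two-lattice carrier (fine sites, coarse sites, block projection `π`,
piecewise-constant pull-back `pull π`), and its HANDOFF §6(i) names the next interface toward the -a side (verbatim): *«binder (a) in block currency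
on nested tori: the defect kernel of a translation-invariant pair is k(x′,z) = Σ_{z′∈B(z)} G₁′(x′−z′) − G₁(πx′−z) (block-summed fine kernel vs coarse
kernel) … typing the exact kernel formula … + the HasMaj reduction is the interface the -a side's momentum estimates must meet.»*  THIS FILE IS THAT
INTERFACE, kernel-checked.

THE PRINT (SHAPES only; nothing of [B9] asserted).  King, CMP **102** (1986) p. 664 *«When x′ ∈ T_{η′}, we denote by x that point in T_η for which
x′ ∈ B^n(x)»* (the pairing whose pull-back is `T4EtaRateCoeffDefect.pull`); Prop. 3.9 (3.73) p. 665 (the SHAPE «uniform majorant × rate factor» of a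
paired-point η-rate, tree `T4EtaRate` header (3)); [Balaban1984PropagatorsII] Lemma 2.1 (2.61) p. 234 (the row sum, `B11SectG.RowSum`);
[Balaban1985BackgroundPropagators] (3.63)–(3.65) pp. 402–403 (MECHANISM of the background step, through n15-b's theorem).

CONTENTS (all [folklore] = linear algebra ∕ finite sums over hypothesis-shaped data).
* §1 ENTRIES.  `𝔇(G′,G)(δ_z)(x₂) = G′(τ₁δ_z)(x₂) − (τ₂Gδ_z)(x₂)`; `pull π δ_z = Σ_{z′∈π⁻¹z} δ_{z′}` (`pull_single`); hence for pull-backs on both sides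
  THE EXACT ENTRY FORMULA `𝔇(δ_z)(x′) = Σ_{z′ ∈ π₁⁻¹z} G′(δ_{z′})(x′) − G(δ_z)(π₂x′)` (`idef_pull_pull_single_apply`).
* §2 REDUCTION, both directions, in the sharp-cube currency `BlockNorm.ofBlocks g blk` of ANY two lattices over ANY [B6] site carrier `g`:
  `Σ_{z ∈ blk₁⁻¹y′} |T(δ_z)(x₂)| ≤ K(blk₂x₂, y′)` ⟹ `HasMaj (ofBlocks blk₁) (ofBlocks blk₂) T K` (`hasMaj_ofBlocks_of_rowSum`); the pointwise form with the
  block count `n₀` (`hasMaj_ofBlocks_of_entry_le`); CONVERSELY `HasMaj … K` ⟹ `|T(δ_z)(x₂)| ≤ K(blk₂x₂, blk₁z)` (`entry_le_of_hasMaj`, `rowSum_le_of_hasMaj`)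
  — the currency is tight up to the block count (the two-lattice sibling of `T4EtaRateSiteOfRatePair.hasMaj_convOp_iff`).
* §3 BINDER (a) IN ENTRY FORM: a paired-point rate of SHAPE (3.73), `|T(δ_z)(x₂)| ≤ C·e^{−δd(blk₂x₂, blk₁z)}·w(blk₁z)`, gives the source-weighted
  majorant `n₀Ce^{−δd}·w(y′)` (`hasMaj_ofBlocks_of_pairedRate`) with `‖n₀Ce^{−δd}‖_ρ ≤ n₀Cc` from (2.61) (`wrow_pairedRate`) — exactly the slots
  `hDG`∕`hNG`∕`hmG`; and **`idef_background_propagator_majorant_of_pairedRate`** = n15-b's background step RE-EXPORTED with binder (a) in entry form.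
* §4 NESTED TORI `blockOf : Tor (fine L M) → Tor M` (`⌊·∕L⌋`, King1986 ∕ b05 carrier): the fibre is the block `{L·z + j}` (`mem_fibre_blockOf_iff`,
  `sum_fibre_blockOf`); for a TRANSLATION-INVARIANT pair (entries `g_f(x′ − z′)`, `g_c(x − z)`) n15-b's kernel VERBATIM:
  `𝔇(δ_z)(x′) = Σ_j g_f(x′ − (L·z + j)) − g_c(⌊x′∕L⌋ − z)` (`idef_entry_transl`), and THE INTERFACE packaged (`hasMaj_idef_transl_of_pairedRate`):
  a (3.73)-shaped bound on that difference IS binder (a).  Operators from the unit lattice (identity on sources): `idef_id_pull_single_apply`.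

HONEST FRAMING ∕ LIMITS.  MECHANISM ONLY: lattices, projections, site assignments, operators are data; nothing about Bałaban's `G(U)`, `H_k`, `C^{(k)}`
is asserted; NE2⁺ and NE2⁰ for the Landau-gauge VECTOR propagators on the honest two-lattice carrier remain NOT PRINTED and NOT proved
(`T4EtaRateDefect` census (N3)); the -a g0 rates live in the collapsed model and are NOT transported here.  Count-neutral (typed 28∕28 · discharged
unchanged); NOT a discharge of N15; one finite T⁴ at fixed ε — NOT infinite volume, NOT OS on ℝ⁴, NOT a mass gap, NOT Clay.
-/

noncomputable section

namespace Summit.QuantumFields.YangMills.BalabanUVNodes.N15.DefectKernel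

open Literature.MathematicalPhysics.QuantumFieldTheory.Balaban1983to89
open Literature.MathematicalPhysics.QuantumFieldTheory.Balaban1983to89.B11SectG (BlockNorm HasMaj RowSum)
open Literature.MathematicalPhysics.QuantumFieldTheory.Balaban1983to89.T4EtaRateDefect (idef idef_apply SlowWeight)
open Literature.MathematicalPhysics.QuantumFieldTheory.Balaban1983to89.T4EtaRateCoeffDefect (pull pull_apply fibre
  mem_fibre)
open Literature.MathematicalPhysics.QuantumFieldTheory.Balaban1983to89.B11AxialTransport190 (abs_le_loc_ofBlocks
  loc_ofBlocks_le)
open Literature.MathematicalPhysics.QuantumFieldTheory.Balaban1983to89.B9SectDWeightedNeumann (WRow wrow_of_exp)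
open Literature.MathematicalPhysics.QuantumFieldTheory.Balaban1983to89.B6RandomWalk (Triangle254)

/-! ## §1 The matrix entries of the η-defect: block-summed fine entry minus coarse entry at the projected point -/

section Entries

variable {X X' X₂ : Type}

/-- THE ENTRY of a defect at a coarse source point `z` and a fine observation point `x₂`:
`𝔇(G′,G)(δ_z)(x₂) = G′(τ₁δ_z)(x₂) − (τ₂(Gδ_z))(x₂)`. [folklore] -/
theorem idef_single_apply [DecidableEq X] {F₁' F₂ : Type} [AddCommGroup F₁'] [Module ℝ F₁'] [AddCommGroup F₂]
    [Module ℝ F₂] (τ₁ : (X → ℝ) →ₗ[ℝ] F₁') (τ₂ : F₂ →ₗ[ℝ] (X₂ → ℝ)) (G' : F₁' →ₗ[ℝ] (X₂ → ℝ))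
    (G : (X → ℝ) →ₗ[ℝ] F₂) (z : X) (x₂ : X₂) :
    idef τ₁ τ₂ G' G (Pi.single z 1) x₂ = G' (τ₁ (Pi.single z 1)) x₂ - τ₂ (G (Pi.single z 1)) x₂ := rfl

/-- With the piecewise-constant pull-back `τ₂ = pull π` on the OUTPUT side the coarse entry is read at the projected
point: `𝔇(δ_z)(x′) = G′(τ₁δ_z)(x′) − G(δ_z)(πx′)`. [folklore] -/
theorem idef_pull_single_apply [DecidableEq X] {F₁' : Type} [AddCommGroup F₁'] [Module ℝ F₁']
    (τ₁ : (X → ℝ) →ₗ[ℝ] F₁') (π : X' → X₂) (G' : F₁' →ₗ[ℝ] (X' → ℝ)) (G : (X → ℝ) →ₗ[ℝ] (X₂ → ℝ))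
    (z : X) (x' : X') :
    idef τ₁ (pull π) G' G (Pi.single z 1) x' = G' (τ₁ (Pi.single z 1)) x' - G (Pi.single z 1) (π x') := rfl

variable [Fintype X'] [DecidableEq X] [DecidableEq X']

/-- THE PULL-BACK OF A POINT MASS IS THE INDICATOR OF ITS BLOCK: `pull π δ_z = Σ_{z′ ∈ π⁻¹z} δ_{z′}`. [folklore] -/
theorem pull_single (π : X' → X) (z : X) :
    pull π (Pi.single z (1 : ℝ)) = ∑ z' ∈ fibre π z, Pi.single z' (1 : ℝ) := by
  funext x'
  rw [pull_apply, Finset.sum_apply]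
  simp only [Pi.single_apply]
  rw [Finset.sum_ite_eq]
  simp only [mem_fibre]

/-- Hence a linear map applied to a pulled-back point mass is the BLOCK SUM of its entries:
`G′(pull π δ_z) = Σ_{z′ ∈ π⁻¹z} G′(δ_{z′})`. [folklore] -/
theorem map_pull_single {F : Type} [AddCommGroup F] [Module ℝ F] (π : X' → X) (G' : (X' → ℝ) →ₗ[ℝ] F) (z : X) :
    G' (pull π (Pi.single z 1)) = ∑ z' ∈ fibre π z, G' (Pi.single z' 1) := by
  rw [pull_single, map_sum]

/-- **THE EXACT ENTRY FORMULA** for the pull-back transports on both sides (`π₁` on sources, `π₂` on observations):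
`𝔇(G′,G)(δ_z)(x′) = Σ_{z′ ∈ π₁⁻¹z} G′(δ_{z′})(x′) − G(δ_z)(π₂x′)` — the block-summed fine entry minus the coarse entry at
the projected point.  For a translation-invariant pair this is `Σ_{z′ ∈ B(z)} G₁′(x′ − z′) − G₁(πx′ − z)` (§4). [folklore] -/
theorem idef_pull_pull_single_apply {X₂' : Type} (π₁ : X' → X) (π₂ : X₂' → X₂)
    (G' : (X' → ℝ) →ₗ[ℝ] (X₂' → ℝ)) (G : (X → ℝ) →ₗ[ℝ] (X₂ → ℝ)) (z : X) (x' : X₂') :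
    idef (pull π₁) (pull π₂) G' G (Pi.single z 1) x' =
      (∑ z' ∈ fibre π₁ z, G' (Pi.single z' 1) x') - G (Pi.single z 1) (π₂ x') := by
  rw [idef_pull_single_apply, map_pull_single, Finset.sum_apply]

end Entries

/-! ## §2 Entries ⟺ block majorants in the sharp-cube currency `BlockNorm.ofBlocks` -/

section Reduction

variable {X X₂ : Type} [Fintype X] [Fintype X₂] [DecidableEq X] {g : B6.Geometry}

/-- A point mass has sharp-cube size `1` on its own cube. [folklore] -/
theorem loc_ofBlocks_single (blk : X → g.Site) (z : X) :
    (BlockNorm.ofBlocks g blk).loc (blk z) (Pi.single z (1 : ℝ)) = 1 := by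
  refine le_antisymm (loc_ofBlocks_le blk _ zero_le_one fun x _ => ?_) ?_
  · by_cases hx : x = z
    · subst hx; simp
    · simp [hx]
  · simpa using abs_le_loc_ofBlocks blk (Pi.single z (1 : ℝ)) (x' := z) rfl

/-- A point mass is localised on its own cube. [folklore] -/
theorem isLoc_ofBlocks_single (blk : X → g.Site) (z : X) :
    (BlockNorm.ofBlocks g blk).IsLoc (blk z) (Pi.single z (1 : ℝ)) := by
  intro x hx
  have hxz : x ≠ z := fun h => hx (by rw [h])
  simp [hxz]

/-- **READOUT (block majorant ⇒ entries).**  A block majorant `K` between the sharp cube norms of two lattices bounds every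
matrix entry: `|T(δ_z)(x₂)| ≤ K(blk₂ x₂, blk₁ z)`. [folklore] -/
theorem entry_le_of_hasMaj (blk₁ : X → g.Site) (blk₂ : X₂ → g.Site) {T : (X → ℝ) →ₗ[ℝ] (X₂ → ℝ)}
    {K : g.Site → g.Site → ℝ} (h : HasMaj (BlockNorm.ofBlocks g blk₁) (BlockNorm.ofBlocks g blk₂) T K)
    (z : X) (x₂ : X₂) : |T (Pi.single z 1) x₂| ≤ K (blk₂ x₂) (blk₁ z) := by
  have h1 := h (blk₁ z) (Pi.single z 1) (isLoc_ofBlocks_single blk₁ z) (blk₂ x₂)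
  rw [loc_ofBlocks_single, mul_one] at h1
  exact (abs_le_loc_ofBlocks blk₂ (T (Pi.single z 1)) rfl).trans h1

omit [Fintype X₂] in
/-- A localised input decomposes over the point masses of its cube, and so does its image. [folklore] -/
theorem apply_eq_sum_of_isLoc (blk₁ : X → g.Site) (T : (X → ℝ) →ₗ[ℝ] (X₂ → ℝ)) {y' : g.Site} {μ : X → ℝ}
    (hμ : (BlockNorm.ofBlocks g blk₁).IsLoc y' μ) (S : Finset X) (hS : ∀ z, blk₁ z = y' → z ∈ S) (x₂ : X₂) :
    T μ x₂ = ∑ z ∈ S, μ z * T (Pi.single z 1) x₂ := by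
  have hμ' : ∀ z : X, blk₁ z ≠ y' → μ z = 0 := hμ
  have hdec : μ = ∑ z ∈ S, μ z • (Pi.single z (1 : ℝ) : X → ℝ) := by
    funext x
    rw [Finset.sum_apply]
    simp only [Pi.smul_apply, Pi.single_apply, smul_eq_mul, mul_ite, mul_one, mul_zero]
    rw [Finset.sum_ite_eq]
    split_ifs with hx
    · rfl
    · by_contra hne
      exact hx (hS x (by by_contra hb; exact hne (hμ' x hb)))
  conv_lhs => rw [hdec]
  simp [map_sum, Finset.sum_apply]

/-- **REDUCTION (entries ⇒ block majorant), sharp form.**  If for every fine observation point `x₂` and every source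
cube `y′` the entries from the sources of `y′` have total size `Σ_{z ∈ blk₁⁻¹y′} |T(δ_z)(x₂)| ≤ K(blk₂ x₂, y′)`, then `K` is
a block majorant of `T` between the sharp cube norms (the input is bounded by its cube sup, source by source). [folklore] -/
theorem hasMaj_ofBlocks_of_rowSum [DecidableEq g.Site] (blk₁ : X → g.Site) (blk₂ : X₂ → g.Site)
    {T : (X → ℝ) →ₗ[ℝ] (X₂ → ℝ)} {K : g.Site → g.Site → ℝ} (hK : ∀ y y', 0 ≤ K y y')
    (h : ∀ (x₂ : X₂) (y' : g.Site), ∑ z ∈ fibre blk₁ y', |T (Pi.single z 1) x₂| ≤ K (blk₂ x₂) y') :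
    HasMaj (BlockNorm.ofBlocks g blk₁) (BlockNorm.ofBlocks g blk₂) T K := by
  intro y' μ hμ y
  refine loc_ofBlocks_le blk₂ _ (mul_nonneg (hK y y') ((BlockNorm.ofBlocks g blk₁).loc_nonneg y' μ))
    fun x₂ hx₂ => ?_
  rw [apply_eq_sum_of_isLoc blk₁ T hμ (fibre blk₁ y') (fun z hz => (mem_fibre blk₁ y' z).2 hz) x₂]
  calc |∑ z ∈ fibre blk₁ y', μ z * T (Pi.single z 1) x₂|
      ≤ ∑ z ∈ fibre blk₁ y', |μ z * T (Pi.single z 1) x₂| := Finset.abs_sum_le_sum_abs _ _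
    _ ≤ ∑ z ∈ fibre blk₁ y', (BlockNorm.ofBlocks g blk₁).loc y' μ * |T (Pi.single z 1) x₂| :=
        Finset.sum_le_sum fun z hz => by
          rw [abs_mul]
          exact mul_le_mul_of_nonneg_right (abs_le_loc_ofBlocks blk₁ μ ((mem_fibre blk₁ y' z).1 hz))
            (abs_nonneg _)
    _ = (∑ z ∈ fibre blk₁ y', |T (Pi.single z 1) x₂|) * (BlockNorm.ofBlocks g blk₁).loc y' μ := by
        rw [Finset.sum_mul]
        exact Finset.sum_congr rfl fun z _ => mul_comm _ _
    _ ≤ K y y' * (BlockNorm.ofBlocks g blk₁).loc y' μ := by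
        rw [← hx₂]
        exact mul_le_mul_of_nonneg_right (h x₂ y') ((BlockNorm.ofBlocks g blk₁).loc_nonneg y' μ)

/-- **REDUCTION, pointwise form.**  An entrywise bound `|T(δ_z)(x₂)| ≤ κ(blk₂ x₂, blk₁ z)` (`κ ≥ 0`) on a source lattice
whose cubes hold at most `n₀` points gives the block majorant `n₀·κ`. [folklore] -/
theorem hasMaj_ofBlocks_of_entry_le [DecidableEq g.Site] (blk₁ : X → g.Site) (blk₂ : X₂ → g.Site)
    {T : (X → ℝ) →ₗ[ℝ] (X₂ → ℝ)} {κ : g.Site → g.Site → ℝ} {n₀ : ℕ} (hκ : ∀ y y', 0 ≤ κ y y')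
    (hn₀ : ∀ y', (fibre blk₁ y').card ≤ n₀)
    (h : ∀ (x₂ : X₂) (z : X), |T (Pi.single z 1) x₂| ≤ κ (blk₂ x₂) (blk₁ z)) :
    HasMaj (BlockNorm.ofBlocks g blk₁) (BlockNorm.ofBlocks g blk₂) T (fun y y' => n₀ * κ y y') := by
  refine hasMaj_ofBlocks_of_rowSum blk₁ blk₂ (fun y y' => mul_nonneg (Nat.cast_nonneg _) (hκ y y'))
    fun x₂ y' => ?_
  calc ∑ z ∈ fibre blk₁ y', |T (Pi.single z 1) x₂| ≤ ∑ z ∈ fibre blk₁ y', κ (blk₂ x₂) y' :=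
        Finset.sum_le_sum fun z hz => by
          have hz' : blk₁ z = y' := (mem_fibre blk₁ y' z).1 hz
          simpa only [hz'] using h x₂ z
    _ = (fibre blk₁ y').card * κ (blk₂ x₂) y' := by rw [Finset.sum_const, nsmul_eq_mul]
    _ ≤ n₀ * κ (blk₂ x₂) y' := mul_le_mul_of_nonneg_right (by exact_mod_cast hn₀ y') (hκ _ _)

/-- THE CURRENCY IS TIGHT: conversely a block majorant `K` gives the row-sum bound with `(#blk₁⁻¹y′)·K`. [folklore] -/
theorem rowSum_le_of_hasMaj [DecidableEq g.Site] (blk₁ : X → g.Site) (blk₂ : X₂ → g.Site)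
    {T : (X → ℝ) →ₗ[ℝ] (X₂ → ℝ)} {K : g.Site → g.Site → ℝ}
    (h : HasMaj (BlockNorm.ofBlocks g blk₁) (BlockNorm.ofBlocks g blk₂) T K) (x₂ : X₂) (y' : g.Site) :
    ∑ z ∈ fibre blk₁ y', |T (Pi.single z 1) x₂| ≤ (fibre blk₁ y').card * K (blk₂ x₂) y' := by
  calc ∑ z ∈ fibre blk₁ y', |T (Pi.single z 1) x₂| ≤ ∑ z ∈ fibre blk₁ y', K (blk₂ x₂) y' :=
        Finset.sum_le_sum fun z hz => by
          have hz' : blk₁ z = y' := (mem_fibre blk₁ y' z).1 hz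
          simpa only [hz'] using entry_le_of_hasMaj blk₁ blk₂ h z x₂
    _ = (fibre blk₁ y').card * K (blk₂ x₂) y' := by rw [Finset.sum_const, nsmul_eq_mul]

end Reduction

/-! ## §3 Binder (a) of the background step, IN ENTRY FORM: a (3.73)-shaped paired-point rate ⟹ `hDG`, `hNG`, `hmG` -/

section BinderA

variable {X X₂ : Type} [Fintype X] [Fintype X₂] [DecidableEq X] {g : B6.Geometry} [DecidableEq g.Site]

/-- **BINDER (a) FROM A PAIRED-POINT RATE.**  An entrywise η-rate of KING'S SHAPE (3.73) — `|T(δ_z)(x₂)| ≤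
C·e^{−δ·d(blk₂x₂, blk₁z)}·w(blk₁ z)`, the uniform majorant of the object times a RATE WEIGHT `w` read at the SOURCE cube (for
the η-rate weight `w = T4EtaRateDefect.rateWeight γ` this is `(η/L^{j′}η)^γ`; at the unit scale a constant `θ^k`) — on a source
lattice with at most `n₀` points per cube gives the SOURCE-WEIGHTED block majorant `N(y,y′)·w(y′)`, `N = n₀·C·e^{−δd}`: the
shape of the slot `hDG` of `BalabanUVNodes.N15.BackgroundStep.idef_background_propagator_majorant` (and of `hDS`∕`hDK` of
`T4EtaRateDefect.idef_neumann_majorant`). [cite: King1986, Prop. 3.9 (3.73) p.665 (shape of the paired-point rate)] -/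
theorem hasMaj_ofBlocks_of_pairedRate (blk₁ : X → g.Site) (blk₂ : X₂ → g.Site) {T : (X → ℝ) →ₗ[ℝ] (X₂ → ℝ)}
    {w : g.Site → ℝ} {C δ : ℝ} {n₀ : ℕ} (hC : 0 ≤ C) (hw : ∀ y, 0 ≤ w y) (hn₀ : ∀ y', (fibre blk₁ y').card ≤ n₀)
    (h : ∀ (x₂ : X₂) (z : X),
      |T (Pi.single z 1) x₂| ≤ C * Real.exp (-(δ * g.dist (blk₂ x₂) (blk₁ z))) * w (blk₁ z)) :
    HasMaj (BlockNorm.ofBlocks g blk₁) (BlockNorm.ofBlocks g blk₂) T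
      (fun y y' => n₀ * C * Real.exp (-(δ * g.dist y y')) * w y') := by
  have key := hasMaj_ofBlocks_of_entry_le blk₁ blk₂
    (κ := fun y y' => C * Real.exp (-(δ * g.dist y y')) * w y')
    (fun y y' => mul_nonneg (mul_nonneg hC (Real.exp_nonneg _)) (hw y')) hn₀ h
  exact key.mono fun y y' => le_of_eq (by ring)

omit [Fintype X] [Fintype X₂] [DecidableEq X] [DecidableEq g.Site] in
/-- … its weighted row-sum norm: `‖n₀Ce^{−δd}‖_ρ ≤ n₀·C·c` from the row sum (2.61) at rate `σ` with `ρ + σ ≤ δ`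
(`B9SectDWeightedNeumann.wrow_of_exp`) — the slot `hmG`; and `N ≥ 0` — the slot `hNG`. [cite: Balaban1984PropagatorsII, Lemma 2.1 (2.61) p.234] -/
theorem wrow_pairedRate {C δ ρ σ c : ℝ} {n₀ : ℕ} (hd : ∀ a b : g.Site, 0 ≤ g.dist a b) (hrow : RowSum g σ c)
    (hC : 0 ≤ C) (hρδ : ρ + σ ≤ δ) :
    WRow g ρ (fun y y' => n₀ * C * Real.exp (-(δ * g.dist y y'))) (n₀ * C * c) :=
  wrow_of_exp hd hrow (mul_nonneg (Nat.cast_nonneg _) hC) hρδ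

omit [Fintype X] [Fintype X₂] [DecidableEq X] [DecidableEq g.Site] in
/-- see `wrow_pairedRate`. [folklore] -/
theorem pairedRate_kernel_nonneg {C δ : ℝ} {n₀ : ℕ} (hC : 0 ≤ C) (y y' : g.Site) :
    0 ≤ n₀ * C * Real.exp (-(δ * g.dist y y')) :=
  mul_nonneg (mul_nonneg (Nat.cast_nonneg _) hC) (Real.exp_nonneg _)

/-- **THE BACKGROUND STEP WITH BINDER (a) IN ENTRY FORM** (`BalabanUVNodes.N15.BackgroundStep.idef_background_propagator_majorant`
BY NAME, source space = the sharp cube norm of the coarse source lattice `X`, target space = that of the fine observation lattice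
`X₂`; every other binder verbatim).  Binder (a) — the η-defect `𝔇(G₁′, G₁) = G₁′τ₁ − τ₂G₁` of the `U ≡ 1` propagators — is
supplied as a PAIRED-POINT RATE of the printed shape (3.73) on its matrix entries, `|𝔇(G₁′,G₁)(δ_z)(x₂)| ≤
c_G·e^{−δ_G d(blk₂x₂, blk₁z)}·w(blk₁z)`, together with the block count `n₀` of the source lattice and the row sum (2.61) at a
rate `σ_G` with `ρ + σ_G ≤ δ_G`; THEN `𝔇(X′, X)` of the background propagators `X = G₁ + (G₁V)X`, `X′ = G₁′ + (G₁′V′)X′` has the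
majorant `(m_G + m_G·A_V·C + c_V)(1 − κ′m′)⁻¹·e^{−ρd}·w(y′)` with `m_G = n₀·c_G·c₁`. [cite: Balaban1985BackgroundPropagators, (3.63)–(3.65) pp.402–403 (mechanism); King1986, Prop. 3.9 (3.73) p.665 (shape of binder (a))] -/
theorem idef_background_propagator_majorant_of_pairedRate (blk₁ : X → g.Site) (blk₂ : X₂ → g.Site)
    {F₂ F₁' : Type} [AddCommGroup F₂] [Module ℝ F₂] [AddCommGroup F₁'] [Module ℝ F₁']
    {τ₁ : (X → ℝ) →ₗ[ℝ] F₁'} {τ₂ : F₂ →ₗ[ℝ] (X₂ → ℝ)}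
    {G₁ Xc : (X → ℝ) →ₗ[ℝ] F₂} {V : F₂ →ₗ[ℝ] (X → ℝ)} {G₁' Xf : F₁' →ₗ[ℝ] (X₂ → ℝ)} {V' : (X₂ → ℝ) →ₗ[ℝ] F₁'}
    {N' : g.Site → g.Site → ℝ} {w : g.Site → ℝ} {m' A_V c_V M₀ ρ σ C c_G δ_G σ_G c₁ : ℝ} {n₀ : ℕ}
    (htri : Triangle254 g) (hd : ∀ a b : g.Site, 0 ≤ g.dist a b) (hρ : 0 ≤ ρ)
    (hw : ∀ y, 0 ≤ w y) (hsw : SlowWeight g σ C w) (hC : 0 ≤ C) (hAV : 0 ≤ A_V) (hcV : 0 ≤ c_V) (hM₀ : 0 ≤ M₀)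
    (hN' : ∀ x y, 0 ≤ N' x y) (hm' : WRow g ρ N' m')
    (hcG : 0 ≤ c_G) (hn₀ : ∀ y', (fibre blk₁ y').card ≤ n₀) (hrow : RowSum g σ_G c₁) (hρδ : ρ + σ_G ≤ δ_G)
    (hDG : ∀ (x₂ : X₂) (z : X), |idef τ₁ τ₂ G₁' G₁ (Pi.single z 1) x₂| ≤
      c_G * Real.exp (-(δ_G * g.dist (blk₂ x₂) (blk₁ z))) * w (blk₁ z))
    (hfix : Xc = G₁ + (G₁ ∘ₗ V) ∘ₗ Xc) (hfix' : Xf = G₁' + (G₁' ∘ₗ V') ∘ₗ Xf)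
    (hK' : HasMaj (BlockNorm.ofBlocks g blk₂) (BlockNorm.ofBlocks g blk₂) (G₁' ∘ₗ V') N')
    (hVX : HasMaj (BlockNorm.ofBlocks g blk₁) (BlockNorm.ofBlocks g blk₁) (V ∘ₗ Xc)
      (fun y y' => A_V * Real.exp (-((ρ + σ) * g.dist y y'))))
    (hDV : HasMaj (BlockNorm.ofBlocks g blk₁) (BlockNorm.ofBlocks g blk₂) (G₁' ∘ₗ idef τ₂ τ₁ V' V ∘ₗ Xc)
      (fun y y' => c_V * Real.exp (-(ρ * g.dist y y')) * w y'))
    (hap : HasMaj (BlockNorm.ofBlocks g blk₁) (BlockNorm.ofBlocks g blk₂) (idef τ₁ τ₂ Xf Xc) (fun _ y' => M₀ * w y'))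
    (hq' : (BlockNorm.ofBlocks g blk₂).κ * m' < 1) :
    HasMaj (BlockNorm.ofBlocks g blk₁) (BlockNorm.ofBlocks g blk₂) (idef τ₁ τ₂ Xf Xc)
      (fun y y' => (n₀ * c_G * c₁ + n₀ * c_G * c₁ * A_V * C + c_V) * (1 - (BlockNorm.ofBlocks g blk₂).κ * m')⁻¹ *
        Real.exp (-(ρ * g.dist y y')) * w y') := by
  have key := BackgroundStep.idef_background_propagator_majorant htri hd hρ hw hsw hC hAV hcV hM₀ hN' hm'
    (fun y y' => pairedRate_kernel_nonneg (δ := δ_G) (n₀ := n₀) hcG y y') (wrow_pairedRate hd hrow hcG hρδ)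
    hfix hfix' hK' hVX (hasMaj_ofBlocks_of_pairedRate blk₁ blk₂ hcG hw hn₀ hDG) hDV hap hq'
  refine key.mono fun y y' => le_of_eq ?_
  have hκ : (BlockNorm.ofBlocks g blk₁).κ = 1 := rfl
  rw [hκ]
  ring

end BinderA

/-! ## §4 The translation-invariant pair on nested tori: n15-b's defect kernel `Σ_{z′∈B(z)} G₁′(x′ − z′) − G₁(πx′ − z)` -/

section Torus

open Literature.MathematicalPhysics.QuantumFieldTheory.Balaban1983to89.B5Prop11Plancherel (Tor fine)
open Literature.MathematicalPhysics.QuantumFieldTheory.King1986.Torus (site blockOf blockEquiv blockOf_site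
  site_injective)

variable {d : ℕ} (L : ℕ) [NeZero L] (M : Fin d → ℕ) [hM : ∀ μ, NeZero (M μ)]

/-- The fibre of the block projection `blockOf : Tor (fine L M) → Tor M` (`⌊·∕L⌋` coordinatewise, `King1986.TorusBlockForm`)
over the coarse site `b` is the block `{L·b + j : j ∈ [0,L)^d}` (`site L M b j`, = b05's `B5Block118.bpt b j`). [folklore] -/
theorem mem_fibre_blockOf_iff (b : Tor M) (x' : Tor (fine L M)) :
    x' ∈ fibre (blockOf L M) b ↔ ∃ j : Fin d → Fin L, x' = site L M b j := by
  rw [mem_fibre]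
  constructor
  · intro h
    refine ⟨((blockEquiv L M).symm x').2, ?_⟩
    have hx : x' = site L M (blockOf L M x') ((blockEquiv L M).symm x').2 := by
      conv_lhs => rw [← (blockEquiv L M).apply_symm_apply x']
      rfl
    rw [← h]
    exact hx
  · rintro ⟨j, rfl⟩
    exact blockOf_site L M b j

/-- Block sums over the fibre are sums over the in-block offsets `j ∈ [0,L)^d`. [folklore] -/
theorem sum_fibre_blockOf (f : Tor (fine L M) → ℝ) (b : Tor M) :
    ∑ z' ∈ fibre (blockOf L M) b, f z' = ∑ j : Fin d → Fin L, f (site L M b j) := by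
  have hinj : Function.Injective (site L M b) := fun j j' h =>
    (Prod.ext_iff.1 (site_injective L M (a₁ := (b, j)) (a₂ := (b, j')) h)).2
  have hset : fibre (blockOf L M) b = Finset.univ.image (site L M b) := by
    ext x'
    rw [mem_fibre_blockOf_iff, Finset.mem_image]
    constructor
    · rintro ⟨j, rfl⟩; exact ⟨j, Finset.mem_univ _, rfl⟩
    · rintro ⟨j, _, rfl⟩; exact ⟨j, rfl⟩
  rw [hset, Finset.sum_image fun j _ j' _ h => hinj h]

/-- **THE DEFECT KERNEL OF A TRANSLATION-INVARIANT PAIR ON NESTED TORI** (n15-b's formula, `HANDOFF-dag-n15-b` §6(i)): if `G₁`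
is the convolution by `g_c` on the coarse torus `Tor M` and `G₁′` the convolution by `g_f` on the fine torus `Tor (fine L M)`
(both read off their matrix entries), then, for the piecewise-constant pull-back along `blockOf` on BOTH sides,
`𝔇(G₁′, G₁)(δ_z)(x′) = Σ_{j ∈ [0,L)^d} g_f(x′ − (L·z + j)) − g_c(⌊x′∕L⌋ − z)` — the block-summed fine kernel minus the coarse
kernel at the projected point. [folklore] -/
theorem idef_entry_transl (G' : (Tor (fine L M) → ℝ) →ₗ[ℝ] (Tor (fine L M) → ℝ)) (G : (Tor M → ℝ) →ₗ[ℝ] (Tor M → ℝ))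
    (gf : Tor (fine L M) → ℝ) (gc : Tor M → ℝ) (hG' : ∀ z' x', G' (Pi.single z' 1) x' = gf (x' - z'))
    (hG : ∀ z x, G (Pi.single z 1) x = gc (x - z)) (z : Tor M) (x' : Tor (fine L M)) :
    idef (pull (blockOf L M)) (pull (blockOf L M)) G' G (Pi.single z 1) x' =
      (∑ j : Fin d → Fin L, gf (x' - site L M z j)) - gc (blockOf L M x' - z) := by
  rw [idef_pull_pull_single_apply, sum_fibre_blockOf, hG]
  simp only [hG']


/-- **THE INTERFACE THE -a SIDE'S TORUS ESTIMATES MUST MEET** (n15-b `HANDOFF-dag-n15-b` §6(i), packaged): a paired-point rate of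
King's shape (3.73) for the block-summed fine kernel against the coarse kernel at the projected point,
`|Σ_{j} g_f(x′ − (L·z + j)) − g_c(⌊x′∕L⌋ − z)| ≤ C·e^{−δ·d(blk₂x′, blk₁z)}·w(blk₁z)`, on a coarse torus with at most `n₀` sites
per cube, IS binder (a) of the background step for the translation-invariant pair: `𝔇(G₁′,G₁)` has the source-weighted block
majorant `n₀·C·e^{−δd(y,y′)}·w(y′)` between the sharp cube norms. [cite: King1986, Prop. 3.9 (3.73) p.665 (shape)] -/
theorem hasMaj_idef_transl_of_pairedRate {g : B6.Geometry} [DecidableEq g.Site] (blk₁ : Tor M → g.Site)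
    (blk₂ : Tor (fine L M) → g.Site) {n₀ : ℕ} (hn₀ : ∀ y', (fibre blk₁ y').card ≤ n₀)
    (G' : (Tor (fine L M) → ℝ) →ₗ[ℝ] (Tor (fine L M) → ℝ)) (G : (Tor M → ℝ) →ₗ[ℝ] (Tor M → ℝ))
    (gf : Tor (fine L M) → ℝ) (gc : Tor M → ℝ) (hG' : ∀ z' x', G' (Pi.single z' 1) x' = gf (x' - z'))
    (hG : ∀ z x, G (Pi.single z 1) x = gc (x - z)) {w : g.Site → ℝ} {C δ : ℝ} (hC : 0 ≤ C) (hw : ∀ y, 0 ≤ w y)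
    (h : ∀ (x' : Tor (fine L M)) (z : Tor M),
      |(∑ j : Fin d → Fin L, gf (x' - site L M z j)) - gc (blockOf L M x' - z)| ≤
        C * Real.exp (-(δ * g.dist (blk₂ x') (blk₁ z))) * w (blk₁ z)) :
    HasMaj (BlockNorm.ofBlocks g blk₁) (BlockNorm.ofBlocks g blk₂)
      (idef (pull (blockOf L M)) (pull (blockOf L M)) G' G)
      (fun y y' => n₀ * C * Real.exp (-(δ * g.dist y y')) * w y') :=
  hasMaj_ofBlocks_of_pairedRate blk₁ blk₂ hC hw hn₀ fun x' z => by
    rw [idef_entry_transl L M G' G gf gc hG' hG]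
    exact h x' z

/-- The same for an operator FROM the unit lattice `Tor M` TO the fine tori (the shape of the minimisers `a_kG_kQ_k^*` ∕ of [B5]
(1.63) `H_k`): identity transport on sources, pull-back on observations, `𝔇(H′,H)(δ_b)(x′) = H′(δ_b)(x′) − H(δ_b)(πx′)` —
King's «x′ ∈ B^n(x)» difference. [cite: King1986, p.664 (pairing convention) + Prop. 3.8 (3.71) (shape)] -/
theorem idef_id_pull_single_apply {X X₁ X₂ : Type} [DecidableEq X₁] (pr : X₂ → X) (H' : (X₁ → ℝ) →ₗ[ℝ] (X₂ → ℝ))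
    (H : (X₁ → ℝ) →ₗ[ℝ] (X → ℝ)) (b : X₁) (x' : X₂) :
    idef LinearMap.id (pull pr) H' H (Pi.single b 1) x' = H' (Pi.single b 1) x' - H (Pi.single b 1) (pr x') := rfl

end Torus

end Summit.QuantumFields.YangMills.BalabanUVNodes.N15.DefectKernel
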